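import Literature.NumberTheory.PAdicHodge.EisensteinCoeffWittLubinTate
import HarnessLib

/-!
# Frobenius and Teichmüller digits on the fixed Witt vectors `W(k_F) = W(k̄)^{Γ_F}`

Topic `Literature/NumberTheory/PAdicHodge`; THEOREMS ONLY. First instalment of the classification of the
`ℚ_p`-embeddings of a `p`-adic field `F` restricted to `W(k_F)` (solo-Langlands-informed Stage E2.9c, memo
`work/s113/E29.md` §5): the Witt-vector algebra it rests on.

* §1 the Witt Frobenius `φ` commutes with `𝕎(σ̄)` (`wittGal_frobenius`), hence preserves `W(k_F)`
  (`frobenius_mem_wittFixed`, iterates), and `𝕎(ι♭) ∘ φ = φ ∘ 𝕎(ι♭)` for the embedding `W(k̄) → 𝔸_inf(F)`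
  (`frobenius_wittToAinf`, `frobenius_wittFixedToAinf`);
* §2 **Teichmüller digits**: the zeroth Witt component of a fixed vector is fixed, its Teichmüller lift is fixed, and
  **`w = [w₀] + p·w'` with `w' ∈ W(k_F)`** (`exists_coe_eq_teichmuller_add_natCast_mul`; `k̄` perfect, `W(k̄)` a domain);
  iterating, `w = Σ_{i<m} [a_i] p^i + p^m w_m` with fixed digits `a_i` and `w_m ∈ W(k_F)` (`exists_coe_eq_sum_teichmuller_add`);
* §3 fixed residues satisfy `a^{q_F} = a` (an arithmetic Frobenius acts on `k̄` by `y ↦ y^{q_F}`), so their Teichmüller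
  lifts are roots of `X^{q_F} − X` in `W(k̄)` and in `ℂ_F` (`wittToC_teichmuller_pow_residueFieldCard`);
* §4 Teichmüller lifts are separated by their residues in `𝒪̂_{F^nr}` (`wittToCompletion_teichmuller_injective`,
  `teichmuller_eq_of_sub_mem_maximalIdeal`) — the rigidity used to compare an embedding with `θ ∘ φ^j` on digits.

No definitions, no named facts, no instances, no `sorry`.

## References
* J.-P. Serre, *Local Fields* (GTM 67, 1979), Ch. II §5 Thm. 3–4, Prop. 8, Prop. 10, §6 Thm. 7. [SerreLocalFields1979]
* J.-M. Fontaine, *Le corps des périodes p-adiques*, Astérisque 223 (1994), Exp. II §1.2. [FontaineAsterisque223III]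
-/

noncomputable section

open IsLocalRing WittVector

namespace Literature.NumberTheory.PAdicHodge

open Literature.NumberTheory.GaloisRepresentations
open Literature.NumberTheory.GaloisRepresentations.IsNonarchimedeanLocalField
open Field ValuativeRel

variable {F : Type} [Field F] [ValuativeRel F] [TopologicalSpace F] [IsNonarchimedeanLocalField F] [CharZero F]
  {p : ℕ} [Fact p.Prime]

/-! ## §1 `φ` commutes with `𝕎(σ̄)` and with `W(k̄) → 𝔸_inf(F)` -/

omit [CharZero F] in
/-- **`𝕎(σ̄) ∘ φ = φ ∘ 𝕎(σ̄)`** on `W(k̄)` (both are coefficientwise: `σ̄` resp. `y ↦ y^p`).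
[cite: SerreLocalFields1979, Ch. II §5 Prop. 10] -/
theorem wittGal_frobenius [CharP (ResidueField (maxUnramifiedCompletion F)) p] (σ : absoluteGaloisGroup F)
    (x : WittVector p (ResidueField (maxUnramifiedCompletion F))) :
    wittGal σ (frobenius x) = frobenius (wittGal σ x) := by
  refine WittVector.ext fun n => ?_
  rw [coeff_wittGal, WittVector.coeff_frobenius_charP, WittVector.coeff_frobenius_charP, coeff_wittGal, map_pow]

omit [CharZero F] in
/-- **`φ` preserves `W(k_F) = W(k̄)^{Γ_F}`.** [cite: SerreLocalFields1979, Ch. II §5 Thm. 4] -/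
theorem frobenius_mem_wittFixed [CharP (ResidueField (maxUnramifiedCompletion F)) p]
    {x : WittVector p (ResidueField (maxUnramifiedCompletion F))} (hx : x ∈ wittFixed F p) :
    frobenius x ∈ wittFixed F p :=
  mem_wittFixed_iff.2 fun σ => by rw [wittGal_frobenius, mem_wittFixed_iff.1 hx σ]

omit [CharZero F] in
/-- `φ^n` preserves `W(k_F)`. [cite: SerreLocalFields1979, Ch. II §5 Thm. 4] -/
theorem iterate_frobenius_mem_wittFixed [CharP (ResidueField (maxUnramifiedCompletion F)) p] (n : ℕ)
    {x : WittVector p (ResidueField (maxUnramifiedCompletion F))} (hx : x ∈ wittFixed F p) :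
    (⇑(frobenius : WittVector p (ResidueField (maxUnramifiedCompletion F)) →+*
      WittVector p (ResidueField (maxUnramifiedCompletion F))))^[n] x ∈ wittFixed F p := by
  induction n with
  | zero => exact hx
  | succ n ih => rw [Function.iterate_succ_apply']; exact frobenius_mem_wittFixed ih

/-- **`φ ∘ 𝕎(ι♭) = 𝕎(ι♭) ∘ φ`**: the embedding `W(k̄) → 𝔸_inf(F) = W(𝒪_{ℂ_F}♭)` (Witt functoriality of `k̄ → 𝒪_{ℂ_F}♭`)
commutes with the Witt Frobenius. [cite: FontaineAsterisque223III, Exp. II §1.2] -/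
theorem frobenius_wittToAinf [Fact (¬ IsUnit (p : maxUnramifiedCompletion F))]
    [CharP (ResidueField (maxUnramifiedCompletion F)) p] [Fact (¬ IsUnit (p : integerC F))]
    (x : WittVector p (ResidueField (maxUnramifiedCompletion F))) :
    frobenius (wittToAinf F p x) = wittToAinf F p (frobenius x) := by
  refine WittVector.ext fun n => ?_
  rw [WittVector.coeff_frobenius_charP, coeff_wittToAinf, coeff_wittToAinf, WittVector.coeff_frobenius_charP, map_pow,
    map_pow]

/-- `φ^n ∘ 𝕎(ι♭) = 𝕎(ι♭) ∘ φ^n`. [cite: FontaineAsterisque223III, Exp. II §1.2] -/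
theorem iterate_frobenius_wittToAinf [Fact (¬ IsUnit (p : maxUnramifiedCompletion F))]
    [CharP (ResidueField (maxUnramifiedCompletion F)) p] [Fact (¬ IsUnit (p : integerC F))] (n : ℕ)
    (x : WittVector p (ResidueField (maxUnramifiedCompletion F))) :
    (⇑(frobenius : Ainf (p := p) F →+* Ainf (p := p) F))^[n] (wittToAinf F p x) =
      wittToAinf F p ((⇑(frobenius : WittVector p (ResidueField (maxUnramifiedCompletion F)) →+*
        WittVector p (ResidueField (maxUnramifiedCompletion F))))^[n] x) := by
  induction n with
  | zero => rfl
  | succ n ih => rw [Function.iterate_succ_apply', Function.iterate_succ_apply', ih, frobenius_wittToAinf]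

/-- `φ (wittFixedToAinf w) = wittFixedToAinf (φ w)` for `w ∈ W(k_F)`. [cite: FontaineAsterisque223III, Exp. II §1.2] -/
theorem frobenius_wittFixedToAinf [Fact (¬ IsUnit (p : maxUnramifiedCompletion F))]
    [CharP (ResidueField (maxUnramifiedCompletion F)) p] [Fact (¬ IsUnit (p : integerC F))]
    (hp : valuation F p < 1) (x : wittFixed F p) :
    frobenius (wittFixedToAinf F p hp x) =
      wittFixedToAinf F p hp ⟨frobenius (x : WittVector p (ResidueField (maxUnramifiedCompletion F))),
        frobenius_mem_wittFixed x.2⟩ := by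
  rw [wittFixedToAinf_apply, wittFixedToAinf_apply, frobenius_wittToAinf]

/-! ## §2 Teichmüller digits of fixed Witt vectors -/

omit [CharZero F] in
/-- The zeroth Witt component of a fixed vector is a fixed element of `k̄`. [cite: SerreLocalFields1979, Ch. II §5 Prop. 8] -/
theorem residueGal_coeff_zero_coe_wittFixed (σ : absoluteGaloisGroup F) (x : wittFixed F p) :
    residueGal σ ((x : WittVector p (ResidueField (maxUnramifiedCompletion F))).coeff 0) =
      (x : WittVector p (ResidueField (maxUnramifiedCompletion F))).coeff 0 := by
  conv_rhs => rw [← wittGal_coe_wittFixed σ x]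
  rw [coeff_wittGal]

omit [CharZero F] in
/-- The Teichmüller lift of the zeroth component of a fixed vector is fixed. [cite: SerreLocalFields1979, Ch. II §5 Prop. 8] -/
theorem teichmuller_coeff_zero_mem_wittFixed (x : wittFixed F p) :
    teichmuller p ((x : WittVector p (ResidueField (maxUnramifiedCompletion F))).coeff 0) ∈ wittFixed F p :=
  teichmuller_mem_wittFixed fun σ => residueGal_coeff_zero_coe_wittFixed σ x

omit [CharZero F] in
set_option maxHeartbeats 2000000 in
/-- **First Teichmüller digit**: every `w ∈ W(k_F)` is `[w₀] + p·w'` with `w' ∈ W(k_F)` — `w − [w₀]` has zeroth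
component `0`, hence equals `V(φ w') = p·w'` (`k̄` perfect), and `w'` is fixed because `W(k̄)` is `p`-torsion-free.
[cite: SerreLocalFields1979, Ch. II §5 Prop. 8, §6 Thm. 7] -/
theorem exists_coe_eq_teichmuller_add_natCast_mul (hp : valuation F p < 1) (x : wittFixed F p) :
    ∃ y : wittFixed F p, (x : WittVector p (ResidueField (maxUnramifiedCompletion F))) =
      teichmuller p ((x : WittVector p (ResidueField (maxUnramifiedCompletion F))).coeff 0) +
        (p : WittVector p (ResidueField (maxUnramifiedCompletion F))) * y := by
  haveI : Fact (¬ IsUnit (p : maxUnramifiedCompletion F)) := ⟨not_isUnit_natCast_completion hp⟩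
  haveI : CharP (ResidueField (maxUnramifiedCompletion F)) p := charP_residueField_completion
  haveI : PerfectRing (ResidueField (maxUnramifiedCompletion F)) p := perfectRing_residueField_completion
  set z : WittVector p (ResidueField (maxUnramifiedCompletion F)) :=
    (x : WittVector p (ResidueField (maxUnramifiedCompletion F))) -
      teichmuller p ((x : WittVector p (ResidueField (maxUnramifiedCompletion F))).coeff 0) with hz
  have hz0 : z.coeff 0 = 0 := by
    have h := map_sub (WittVector.constantCoeff : WittVector p (ResidueField (maxUnramifiedCompletion F)) →+* _)
      (x : WittVector p (ResidueField (maxUnramifiedCompletion F)))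
      (teichmuller p ((x : WittVector p (ResidueField (maxUnramifiedCompletion F))).coeff 0))
    rw [WittVector.constantCoeff_apply, WittVector.constantCoeff_apply, WittVector.constantCoeff_apply,
      teichmuller_coeff_zero, sub_self] at h
    exact h
  have hzV : z = verschiebung (z.shift 1) := by
    have h := WittVector.eq_iterate_verschiebung (x := z) (n := 1) (fun i hi => by
      obtain rfl : i = 0 := Nat.lt_one_iff.1 hi
      exact hz0)
    simpa using h
  obtain ⟨w, hw⟩ := (WittVector.frobenius_bijective p (ResidueField (maxUnramifiedCompletion F))).2 (z.shift 1)
  have hzw : z = w * p := by rw [hzV, ← hw, WittVector.verschiebung_frobenius]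
  have hzfix : ∀ σ : absoluteGaloisGroup F, wittGal σ z = z := fun σ => by
    rw [hz, map_sub, wittGal_coe_wittFixed, (mem_wittFixed_iff.1 (teichmuller_coeff_zero_mem_wittFixed x)) σ]
  have hwfix : w ∈ wittFixed F p := by
    refine mem_wittFixed_iff.2 fun σ => ?_
    have h := hzfix σ
    rw [hzw, map_mul, map_natCast] at h
    exact mul_right_cancel₀ (WittVector.p_nonzero p (ResidueField (maxUnramifiedCompletion F))) h
  refine ⟨⟨w, hwfix⟩, ?_⟩
  show (x : WittVector p (ResidueField (maxUnramifiedCompletion F))) =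
    teichmuller p ((x : WittVector p (ResidueField (maxUnramifiedCompletion F))).coeff 0) +
      (p : WittVector p (ResidueField (maxUnramifiedCompletion F))) * w
  have : (x : WittVector p (ResidueField (maxUnramifiedCompletion F))) =
      teichmuller p ((x : WittVector p (ResidueField (maxUnramifiedCompletion F))).coeff 0) + z := by
    rw [hz, add_sub_cancel]
  conv_lhs => rw [this, hzw, mul_comm]

omit [CharZero F] in
set_option maxHeartbeats 2000000 in
/-- **Teichmüller expansion to depth `m`**: `w = Σ_{i<m} [a_i]·p^i + p^m·w_m` with `Γ_F`-fixed digits `a_i ∈ k̄`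
and `w_m ∈ W(k_F)`. [cite: SerreLocalFields1979, Ch. II §5 Prop. 8] -/
theorem exists_coe_eq_sum_teichmuller_add (hp : valuation F p < 1) (x : wittFixed F p) (m : ℕ) :
    ∃ (a : ℕ → ResidueField (maxUnramifiedCompletion F)) (y : wittFixed F p),
      (∀ i, ∀ σ : absoluteGaloisGroup F, residueGal σ (a i) = a i) ∧
      (x : WittVector p (ResidueField (maxUnramifiedCompletion F))) =
        (∑ i ∈ Finset.range m, teichmuller p (a i) * (p : WittVector p (ResidueField (maxUnramifiedCompletion F))) ^ i) +
          (p : WittVector p (ResidueField (maxUnramifiedCompletion F))) ^ m * y := by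
  induction m with
  | zero => exact ⟨fun _ => 0, x, fun _ σ => map_zero _, by rw [Finset.sum_range_zero, zero_add, pow_zero, one_mul]⟩
  | succ m ih =>
    obtain ⟨a, y, ha, hx⟩ := ih
    obtain ⟨y', hy⟩ := exists_coe_eq_teichmuller_add_natCast_mul hp y
    refine ⟨fun i => if i = m then (y : WittVector p (ResidueField (maxUnramifiedCompletion F))).coeff 0 else a i, y',
      fun i σ => ?_, ?_⟩
    · by_cases hi : i = m
      · simp only [hi, if_true]
        exact residueGal_coeff_zero_coe_wittFixed σ y
      · simp only [hi, if_false]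
        exact ha i σ
    · have hsum : ∑ i ∈ Finset.range m, teichmuller p
          (if i = m then (y : WittVector p (ResidueField (maxUnramifiedCompletion F))).coeff 0 else a i) *
            (p : WittVector p (ResidueField (maxUnramifiedCompletion F))) ^ i =
          ∑ i ∈ Finset.range m, teichmuller p (a i) * (p : WittVector p (ResidueField (maxUnramifiedCompletion F))) ^ i :=
        Finset.sum_congr rfl fun i hi => by rw [if_neg (Finset.mem_range.1 hi).ne]
      simp only [Finset.sum_range_succ, if_true]
      rw [hsum]
      conv_lhs => rw [hx, hy]
      ring

/-! ## §3 Fixed residues are roots of `X^{q_F} − X` -/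

omit [CharZero F] in
/-- **`a^{q_F} = a` for `Γ_F`-fixed `a ∈ k̄`**: an arithmetic Frobenius `σ₀ ∈ Γ_F` acts on `k̄` by `y ↦ y^{q_F}`
(`IsAbsArithFrob.residueGal_eq_pow`). [cite: SerreLocalFields1979, Ch. II §5 Thm. 3] -/
theorem pow_residueFieldCard_eq_of_fixed {a : ResidueField (maxUnramifiedCompletion F)}
    (ha : ∀ σ : absoluteGaloisGroup F, residueGal σ a = a) : a ^ residueFieldCard F = a := by
  obtain ⟨σ₀, hσ₀⟩ := exists_isAbsArithFrob_holds (F := F)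
  rw [← IsAbsArithFrob.residueGal_eq_pow hσ₀, ha σ₀]

omit [CharZero F] in
/-- The Teichmüller lift of a fixed residue is a root of `X^{q_F} − X` in `W(k̄)`. [cite: SerreLocalFields1979, Ch. II §5 Prop. 8] -/
theorem teichmuller_pow_residueFieldCard_eq_of_fixed {a : ResidueField (maxUnramifiedCompletion F)}
    (ha : ∀ σ : absoluteGaloisGroup F, residueGal σ a = a) :
    teichmuller p a ^ residueFieldCard F = teichmuller p a := by
  rw [← map_pow, pow_residueFieldCard_eq_of_fixed ha]

/-- The image in `ℂ_F` of the Teichmüller lift of a fixed residue is a root of `X^{q_F} − X`.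
[cite: SerreLocalFields1979, Ch. II §5 Prop. 8] -/
theorem wittToC_teichmuller_pow_residueFieldCard (hp : valuation F p < 1) {a : ResidueField (maxUnramifiedCompletion F)}
    (ha : ∀ σ : absoluteGaloisGroup F, residueGal σ a = a) :
    wittToC F p hp (teichmuller p a) ^ residueFieldCard F = wittToC F p hp (teichmuller p a) := by
  rw [← map_pow, teichmuller_pow_residueFieldCard_eq_of_fixed ha]

/-- The zeroth digit of `w ∈ W(k_F)` gives a root `wittToC [w₀]` of `X^{q_F} − X` with `wittToC w − wittToC [w₀] ∈ p·wittToC(W(k_F))`.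
[cite: SerreLocalFields1979, Ch. II §5 Prop. 8] -/
theorem exists_wittToC_coe_eq_teichmuller_add (hp : valuation F p < 1) (x : wittFixed F p) :
    ∃ y : wittFixed F p, wittToC F p hp (x : WittVector p (ResidueField (maxUnramifiedCompletion F))) =
      wittToC F p hp (teichmuller p ((x : WittVector p (ResidueField (maxUnramifiedCompletion F))).coeff 0)) +
        (p : CompletedAlgClosure F) * wittToC F p hp (y : WittVector p (ResidueField (maxUnramifiedCompletion F))) := by
  obtain ⟨y, hy⟩ := exists_coe_eq_teichmuller_add_natCast_mul hp x
  refine ⟨y, ?_⟩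
  conv_lhs => rw [hy]
  rw [map_add, map_mul, map_natCast]

/-! ## §4 Teichmüller lifts are separated by their residues in `𝒪̂_{F^nr}` -/

/-- `W(k̄) → 𝒪̂_{F^nr}` sends `[b]` to an element with residue `b`. [cite: SerreLocalFields1979, Ch. II §5 Thm. 4] -/
theorem residue_wittToCompletion_teichmuller [Fact (¬ IsUnit (p : maxUnramifiedCompletion F))]
    [CharP (ResidueField (maxUnramifiedCompletion F)) p]
    [IsAdicComplete (Ideal.span {(p : maxUnramifiedCompletion F)}) (maxUnramifiedCompletion F)]
    (b : ResidueField (maxUnramifiedCompletion F)) :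
    IsLocalRing.residue (maxUnramifiedCompletion F) (wittToCompletion F p (teichmuller p b)) = b := by
  rw [residue_wittToCompletion, teichmuller_coeff_zero]

/-- **`b ↦ (image of [b] in 𝒪̂_{F^nr})` is injective** (different residues). [cite: SerreLocalFields1979, Ch. II §5 Thm. 4] -/
theorem wittToCompletion_teichmuller_injective [Fact (¬ IsUnit (p : maxUnramifiedCompletion F))]
    [CharP (ResidueField (maxUnramifiedCompletion F)) p]
    [IsAdicComplete (Ideal.span {(p : maxUnramifiedCompletion F)}) (maxUnramifiedCompletion F)] :
    Function.Injective fun b : ResidueField (maxUnramifiedCompletion F) => wittToCompletion F p (teichmuller p b) := by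
  intro b b' h
  have h' := congrArg (IsLocalRing.residue (maxUnramifiedCompletion F)) h
  rwa [residue_wittToCompletion_teichmuller, residue_wittToCompletion_teichmuller] at h'

/-- Two Teichmüller lifts with the same image in `𝒪̂_{F^nr}` modulo the maximal ideal are equal: the residue of
`g[b] − g[b']` is `b − b'`. [cite: SerreLocalFields1979, Ch. II §5 Thm. 4] -/
theorem teichmuller_eq_of_sub_mem_maximalIdeal [Fact (¬ IsUnit (p : maxUnramifiedCompletion F))]
    [CharP (ResidueField (maxUnramifiedCompletion F)) p]
    [IsAdicComplete (Ideal.span {(p : maxUnramifiedCompletion F)}) (maxUnramifiedCompletion F)]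
    {b b' : ResidueField (maxUnramifiedCompletion F)}
    (h : wittToCompletion F p (teichmuller p b) - wittToCompletion F p (teichmuller p b') ∈
      IsLocalRing.maximalIdeal (maxUnramifiedCompletion F)) : b = b' := by
  rw [← IsLocalRing.residue_eq_zero_iff, map_sub, residue_wittToCompletion_teichmuller,
    residue_wittToCompletion_teichmuller, sub_eq_zero] at h
  exact h

end Literature.NumberTheory.PAdicHodge

end
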